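import Literature.NumberTheory.GaloisRepresentations.LocallyAlgebraicHeckeCharacterProofs
import Literature.NumberTheory.GaloisRepresentations.WeakAbelianDirectSummandRatExponentProofs
import Literature.NumberTheory.GaloisRepresentations.EmbeddingRigidityProofs
import Literature.NumberTheory.GaloisRepresentations.RayClassPrincipalizationProofs
import Literature.NumberTheory.GaloisRepresentations.DegreeOnePlacesProofs
import HarnessLib

/-!
# Weak abelian direct summands: almost locally algebraic ⟹ locally algebraic ⟹ Hecke (proved; any `K`)

Topic `NumberTheory/GaloisRepresentations`; namespace
`Literature.NumberTheory.GaloisRepresentations`.  A *proofs* file (theorems only; no definition,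
no named fact, no instance).  Steps 3–4 of the proof of Böckle–Hui's Thm. 1.1 (character case,
`exists_heckeCharacter_of_weaklyDivides`) for a GENERAL number field `K`, and the assembly with the
Hecke avatar (`exists_heckeCharacter_of_isLocAlgAt`): a character `ψ` weakly dividing an `E`-rational
`ρ` whose idelic avatar `Ψ = ψ ∘ Art_K` is ALMOST locally algebraic at the places above `ℓ`
(`(∏_{v∣ℓ} Ψ(⟨k⟩_v))^N = ∏_τ τ(k)^{-n_τ}` for `k ≡ 1 mod 𝔭_v^m`, `v ∣ ℓ` — the conclusion of
BH Thm. 2.2 / Waldschmidt for `ψ`) comes from an algebraic Hecke character.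

Source: G. Böckle, C.-Y. Hui, Math. Ann. 393 (2025) [BockleHui2025], §2.7 (proof of Thm. 1.1):
"By Proposition 2.11, `ψ_ℓ` is `E'`-rational … By Proposition 2.12, `ψ_ℓ` is locally algebraic";
Prop. 2.11 (gcd descent off the exceptional eigenvalue locus), Prop. 2.12 (Serre: `ψ^N` locally
algebraic and `ψ` `E'`-rational on enough Frobenii force `ψ` locally algebraic).

## The argument as formalised (no monodromy groups, no base change)

* `natCast_dvd_exponent_of_weaklyDivides` (**`N ∣ n_τ` for every embedding `τ`**).  Fix `τ₀`.
  Uniform data: the level `𝔪 = ∏_{w∣ℓ} 𝔭_w^m` and `H₀` with `𝔭^{H₀} = (π)`, `π ≡ 1 mod^× 𝔪`, for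
  every `𝔭 ∤ 𝔪` (`exists_uniform_rayClass_principalization`); Serre's exponent `N₁` for `Ψ`
  (`IdelicCharacter.exists_pow_prod_map_localUnits_eq`); `B = H₀ N₁ N`; the open neighbourhood
  `U = ⋂_{ζ ∈ μ_B ∖ 1} {σ : charpoly ρ(σ)(ζ ψ(σ)) ≠ 0}` of `1 ∈ Γ_K`; a finite extension `F ⊂ ℚ̄_ℓ` of
  `ℚ` containing `e(E)` and every `τ(K)` (`exists_intermediateField_forall_mem`).  By
  `absoluteGaloisGroup.exists_frobenius_mem_of_mem_nhds_one` there is a place `v` in the density-one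
  set of Def. 2.3, of prime norm `p` (density one), good for `ρ`, `Ψ`, away from `ℓ` and the ramified
  places, with `p ∉ 𝔭_v²` and `p` unramified in `F` (cofinite conditions), and a Frobenius `Φ ∈ U`
  at `v`.  With `𝔭_v^{H₀} = (π)`: the product formula and almost local algebraicity give
  `ψ(Φ)^B = Ψ(⟨ϖ_v⟩)^{H₀N₁N} = ∏_τ τ(π)^{n_τ N₁} =: b₀ ∈ F`, so `ψ(Φ) ∈ F` by the gcd descent
  (`WeaklyDivides.apply_mem_range_of_pow_eq`, as `Φ ∈ U`).  Take a place `w` of `F` over `v` along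
  `τ₀`; along any `τ`, `|τ(π)|_w = |π|_{τ⁻¹(w)}^{e_τ}` (`exists_valuation_comp_eq_pow`) is `1` unless
  `τ⁻¹(w) = 𝔭_v`, which by the rigidity `NumberField.ringHom_eq_of_map_mem` (degree one,
  `p ∉ 𝔭_v²`) happens only for `τ = τ₀`, where `e_{τ₀} = 1` (`p` unramified in `F`).  Taking
  `|·|_w` of `ψ(Φ)^B = b₀`: `B · ord_w ψ(Φ) = H₀ N₁ n_{τ₀}`, i.e. `N ∣ n_{τ₀}`.
* `locAlg_of_almost` (**Part B**): with `n = N n'`, the character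
  `k ↦ (∏_{v∣ℓ}Ψ(⟨k⟩_v)) ∏_τ τ(k)^{n'_τ}` is `N`-torsion valued and within `‖ℓ‖` of `1` for
  `k ≡ 1 mod 𝔭_v^{m'}` (continuity of `Ψ` and `‖τ(k) - 1‖ ≤ ‖ℓ‖` from the congruences,
  `norm_embedding_sub_one_lt`), hence trivial (`PadicAlgCl.eq_one_of_pow_eq_one_of_norm_sub_one_lt`).
* `WeaklyDivides.exists_heckeCharacter_of_almostLocAlg` — assembly with the Hecke avatar.

## References

* [BockleHui2025] §2.7 (proof of Thm. 1.1, Steps 3–4), Prop. 2.11, Prop. 2.12, §3.2.1.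
* [SerreAbelianLadic1968] Ch. III §2.3, §3 (the valuation argument for `E`-rational characters).
* [NeukirchANT1999] Ch. VI §1 (ray classes), Ch. VII §13 (Dirichlet density).
-/

noncomputable section

open scoped NumberField Topology
open NumberField IsDedekindDomain IsDedekindDomain.HeightOneSpectrum Filter Field
open Literature.NumberTheory.LFunctions.NumberField (HasDirichletDensity)

namespace Literature.NumberTheory.GaloisRepresentations

variable {K : Type} [Field K] [NumberField K] {ℓ : ℕ} [Fact ℓ.Prime]

/-! ### Small valuation lemmas -/

/-- `p ∈ 𝔭 ∖ 𝔭²` gives `v_𝔭(p) = exp(-1)`. [folklore] -/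
theorem intValuation_natCast_eq_exp_neg_one {F : Type*} [Field F] [NumberField F]
    (w : HeightOneSpectrum (𝓞 F)) {p : ℕ} (hmem : (p : 𝓞 F) ∈ w.asIdeal) (hsq : (p : 𝓞 F) ∉ w.asIdeal ^ 2) :
    w.intValuation (p : 𝓞 F) = WithZero.exp (-(1 : ℤ)) := by
  have h1 : w.intValuation (p : 𝓞 F) ≤ WithZero.exp (-(1 : ℤ)) := by
    have := (w.intValuation_le_pow_iff_mem (p : 𝓞 F) 1).mpr (by rwa [pow_one])
    simpa using this
  have h2 : ¬ w.intValuation (p : 𝓞 F) ≤ WithZero.exp (-(2 : ℤ)) := fun h =>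
    hsq ((w.intValuation_le_pow_iff_mem (p : 𝓞 F) 2).mp (by simpa using h))
  have hp0 : (p : 𝓞 F) ≠ 0 := fun h0 => by
    rw [h0] at h2
    exact h2 (by simp)
  rw [w.intValuation_if_neg hp0] at h1 h2 ⊢
  rw [WithZero.exp_le_exp] at h1
  rw [WithZero.exp_le_exp, not_le] at h2
  congr 1
  omega

/-- `exp(-1)^e = exp(-1)` forces `e = 1`. [folklore] -/
theorem eq_one_of_exp_neg_one_pow_eq {e : ℕ}
    (h : (WithZero.exp (-(1 : ℤ))) ^ e = WithZero.exp (-(1 : ℤ))) : e = 1 := by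
  rw [← WithZero.exp_nsmul, WithZero.exp_inj, nsmul_eq_mul] at h
  omega

namespace FramedGaloisRep

/-! ### Part A: `N ∣ n_τ` -/

/-- **Böckle–Hui, proof of Thm. 1.1, Steps 3–4 (general `K`): the exponents of an almost locally
algebraic weak abelian direct summand are divisible by `N`.**  See the module docstring for the
statement of the hypotheses (`Ψ = ψ ∘ Art_K` with its almost-everywhere local description; `L` the
set of places above `ℓ`; `(∏_{v∈L} Ψ(⟨k⟩_v))^N = ∏_τ τ(k)^{-n_τ}` for `k ≡ 1 mod 𝔭_v^m` on `L`) and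
the proof. [cite: BockleHui2025, §2.7 (proof of Thm. 1.1), Proposition 2.11, Proposition 2.12] -/
theorem natCast_dvd_exponent_of_weaklyDivides
    {E : Type} [Field E] [NumberField E] (e : E →+* PadicAlgCl ℓ) {d : ℕ}
    {ρ : FramedGaloisRep K (PadicAlgCl ℓ) d} (hρ : ρ.IsRationalOver e)
    {ψ : FramedGaloisRep K (PadicAlgCl ℓ) 1} (h : ψ.WeaklyDivides ρ)
    (Ψ : ideleGroup K →ₜ* (PadicAlgCl ℓ)ˣ) (hK : ∀ x ∈ principalIdeles K, Ψ x = 1)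
    (hΨ : ∀ᶠ v : HeightOneSpectrum (𝓞 K) in cofinite, ψ.IsUnramifiedAt v ∧
      (∀ u : (v.adicCompletionIntegers K)ˣ,
          Ψ (localUnits v (Units.map ((v.adicCompletionIntegers K).subtype : _ →* _) u)) = 1) ∧
      ∀ ϖ : (v.adicCompletion K)ˣ, Valued.v (ϖ : v.adicCompletion K) = WithZero.exp (-1 : ℤ) →
        ψ.HasFrobCharpolyAt v
          (Polynomial.X - Polynomial.C ((Ψ (localUnits v ϖ) : (PadicAlgCl ℓ)ˣ) : PadicAlgCl ℓ)))
    (L : Finset (HeightOneSpectrum (𝓞 K))) (hL : ∀ v, v ∈ L ↔ (ℓ : 𝓞 K) ∈ v.asIdeal)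
    {N : ℕ} (hN : 0 < N) (n : (K →+* PadicAlgCl ℓ) → ℤ) (m : ℕ)
    (hLA : ∀ k : Kˣ, (∀ v ∈ L, Valued.v (algebraMap K (v.adicCompletion K) (k : K) - 1) ≤
        WithZero.exp (-(m : ℤ))) →
      (∏ v ∈ L, ((Ψ (localUnits v (globalToLocalUnits v k)) : (PadicAlgCl ℓ)ˣ) : PadicAlgCl ℓ)) ^ N =
        ∏ τ : K →+* PadicAlgCl ℓ, τ (k : K) ^ (-(n τ)))
    (τ₀ : K →+* PadicAlgCl ℓ) : (N : ℤ) ∣ n τ₀ := by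
  classical
  -- the entry `x σ = ψ(σ)₀₀`
  set x : absoluteGaloisGroup K → PadicAlgCl ℓ := fun σ =>
    (((ψ σ : GL (Fin 1) (PadicAlgCl ℓ)) : Matrix (Fin 1) (Fin 1) (PadicAlgCl ℓ)) 0 0) with hx
  have hxc : Continuous x := ψ.continuous_apply_zero_zero
  have hx1 : x 1 = 1 := by simp only [hx, map_one, Units.val_one, Matrix.one_apply_eq]
  -- (0) raise the level to `m' = m + 1 ≥ 1`
  set m' : ℕ := m + 1 with hm'
  have hm'0 : 0 < m' := Nat.succ_pos m
  have hLA' : ∀ k : Kˣ, (∀ v ∈ L, Valued.v (algebraMap K (v.adicCompletion K) (k : K) - 1) ≤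
        WithZero.exp (-(m' : ℤ))) →
      (∏ v ∈ L, ((Ψ (localUnits v (globalToLocalUnits v k)) : (PadicAlgCl ℓ)ˣ) : PadicAlgCl ℓ)) ^ N =
        ∏ τ : K →+* PadicAlgCl ℓ, τ (k : K) ^ (-(n τ)) := fun k hk =>
    hLA k fun v hv => (hk v hv).trans (WithZero.exp_le_exp.mpr (by omega))
  -- (1) the level `𝔪` and the uniform principalisation exponent `H₀`
  set 𝔪 : Ideal (𝓞 K) := ∏ u ∈ L, u.asIdeal ^ m' with h𝔪def
  have h𝔪 : 𝔪 ≠ ⊥ := prod_pow_ne_bot L m'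
  obtain ⟨H₀, hH₀, hprin⟩ := exists_uniform_rayClass_principalization h𝔪
  -- (2) the ramified set `T`, `S = L ∪ T`, Serre's exponent `N₁`
  have hΨ' := hΨ
  rw [Filter.eventually_cofinite] at hΨ'
  set T : Finset (HeightOneSpectrum (𝓞 K)) := hΨ'.toFinset with hT
  set S : Finset (HeightOneSpectrum (𝓞 K)) := L ∪ T with hSdef
  have hS : ∀ v ∉ S, ∀ u : (v.adicCompletionIntegers K)ˣ,
      Ψ (localUnits v (Units.map ((v.adicCompletionIntegers K).subtype : _ →* _) u)) = 1 := by
    intro v hv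
    have hvT : v ∉ T := fun h' => hv (Finset.mem_union_right _ h')
    have : ¬¬ _ := fun h' => hvT (hΨ'.mem_toFinset.mpr h')
    exact (not_not.mp this).2.1
  have hSfilter : S.filter (fun v => (ℓ : 𝓞 K) ∈ v.asIdeal) = L := by
    ext v
    simp only [Finset.mem_filter, hSdef, Finset.mem_union]
    constructor
    · rintro ⟨-, hv⟩
      exact (hL v).mpr hv
    · intro hv
      exact ⟨Or.inl hv, (hL v).mp hv⟩
  obtain ⟨N₁, hN₁, hserre⟩ := IdelicCharacter.exists_pow_prod_map_localUnits_eq Ψ hK S hS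
  -- (3) `B = H₀ N₁ N` and the neighbourhood `U`
  set B : ℕ := H₀ * N₁ * N with hBdef
  have hB : 0 < B := Nat.mul_pos (Nat.mul_pos hH₀ hN₁) hN
  set Z : Set (PadicAlgCl ℓ) := {ζ | ζ ^ B = 1 ∧ ζ ≠ 1} with hZ
  have hZfin : Z.Finite := by
    refine (Multiset.finite_toSet (Polynomial.nthRoots B (1 : PadicAlgCl ℓ))).subset
      fun z hz => ?_
    simp only [Set.mem_setOf_eq] at hz ⊢
    exact (Polynomial.mem_nthRoots hB).mpr hz.1
  set U : Set (absoluteGaloisGroup K) :=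
    ⋂ ζ ∈ Z, {σ | (FramedRep.charpoly ρ σ).eval (ζ * x σ) ≠ 0} with hU
  have hUo : IsOpen U := by
    refine hZfin.isOpen_biInter fun ζ _ => ?_
    exact isOpen_compl_singleton.preimage (ρ.continuous_eval_charpoly (continuous_const.mul hxc))
  have hU1 : (1 : absoluteGaloisGroup K) ∈ U := by
    refine Set.mem_iInter₂.mpr fun ζ hζ => ?_
    simp only [Set.mem_setOf_eq, hx1, mul_one]
    rw [FramedRep.charpoly, map_one, Units.val_one, Matrix.charpoly_one, Polynomial.eval_pow,
      Polynomial.eval_sub, Polynomial.eval_X, Polynomial.eval_one]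
    exact pow_ne_zero _ (sub_ne_zero.mpr hζ.2)
  have hUn : U ∈ 𝓝 (1 : absoluteGaloisGroup K) := hUo.mem_nhds hU1
  -- (4) the common number field `F ⊂ ℚ̄_ℓ`
  obtain ⟨F, hFfd, heF, hτF⟩ := exists_intermediateField_forall_mem E K e
  haveI : FiniteDimensional ℚ F := hFfd
  haveI : NumberField F := { to_charZero := inferInstance, to_finiteDimensional := hFfd }
  set iF : F →+* PadicAlgCl ℓ := (IntermediateField.val F).toRingHom with hiF
  have hiF : ∀ y : F, iF y = (y : PadicAlgCl ℓ) := fun _ => rfl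
  have hiFinj : Function.Injective iF := fun a b hab => Subtype.ext hab
  set eF : E →+* F := e.codRestrict F heF with heFdef
  set τF : (K →+* PadicAlgCl ℓ) → (K →+* F) := fun τ => τ.codRestrict F (hτF τ) with hτFdef
  have hτF_val : ∀ τ (y : K), ((τF τ y : F) : PadicAlgCl ℓ) = τ y := fun _ _ => rfl
  have hτFinj : ∀ τ τ', τF τ = τF τ' → τ = τ' := by
    intro τ τ' hττ'
    refine RingHom.ext fun y => ?_
    rw [← hτF_val τ y, ← hτF_val τ' y, hττ']
  have heF_comp : iF.comp eF = e := RingHom.ext fun _ => rfl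
  -- (5) the cofinite good set and the density-one set
  have hbadF := finite_setOf_under_mem (K := K) (finite_setOf_not_isUnramifiedIn ℚ F)
  have hG : ∀ᶠ v : HeightOneSpectrum (𝓞 K) in cofinite,
      (ρ.IsUnramifiedAt v ∧ ∃ P : Polynomial E, ρ.HasFrobCharpolyAt v (P.map e)) ∧
      (ψ.IsUnramifiedAt v ∧
        (∀ u : (v.adicCompletionIntegers K)ˣ,
          Ψ (localUnits v (Units.map ((v.adicCompletionIntegers K).subtype : _ →* _) u)) = 1) ∧
        ∀ ϖ : (v.adicCompletion K)ˣ, Valued.v (ϖ : v.adicCompletion K) = WithZero.exp (-1 : ℤ) →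
          ψ.HasFrobCharpolyAt v
            (Polynomial.X - Polynomial.C ((Ψ (localUnits v ϖ) : (PadicAlgCl ℓ)ˣ) : PadicAlgCl ℓ))) ∧
      v ∉ S ∧
      ((Ideal.absNorm v.asIdeal).Prime → ((Ideal.absNorm v.asIdeal : ℕ) : 𝓞 K) ∉ v.asIdeal ^ 2) ∧
      Algebra.IsUnramifiedIn (𝓞 F) (v.under (𝓞 ℚ)).asIdeal := by
    refine (FramedGaloisRep.isRationalOver_iff.mp hρ).and (hΨ.and ((Finset.eventually_cofinite_notMem S).and
      ((eventually_natCast_absNorm_not_mem_sq (K := K)).and ?_)))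
    refine Filter.eventually_cofinite.mpr (hbadF.subset fun v hv => ?_)
    simpa using hv
  have hG1 : HasDirichletDensity K {v | (ρ.IsUnramifiedAt v ∧ ∃ P : Polynomial E,
      ρ.HasFrobCharpolyAt v (P.map e)) ∧
      (ψ.IsUnramifiedAt v ∧
        (∀ u : (v.adicCompletionIntegers K)ˣ,
          Ψ (localUnits v (Units.map ((v.adicCompletionIntegers K).subtype : _ →* _) u)) = 1) ∧
        ∀ ϖ : (v.adicCompletion K)ˣ, Valued.v (ϖ : v.adicCompletion K) = WithZero.exp (-1 : ℤ) →
          ψ.HasFrobCharpolyAt v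
            (Polynomial.X - Polynomial.C ((Ψ (localUnits v ϖ) : (PadicAlgCl ℓ)ˣ) : PadicAlgCl ℓ))) ∧
      v ∉ S ∧
      ((Ideal.absNorm v.asIdeal).Prime → ((Ideal.absNorm v.asIdeal : ℕ) : 𝓞 K) ∉ v.asIdeal ^ 2) ∧
      Algebra.IsUnramifiedIn (𝓞 F) (v.under (𝓞 ℚ)).asIdeal} 1 :=
    hasDirichletDensity_one_of_eventually hG
  obtain ⟨𝓛, h𝓛, hdiv⟩ := id h
  have h𝓛' := h𝓛.inter_of_one (hG1.inter_of_one (hasDirichletDensity_one_setOf_prime_absNorm K))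
  -- (6) the good place `v` and a Frobenius `Φ ∈ U` at it
  obtain ⟨v, ⟨hv𝓛, ⟨⟨-, P, hP⟩, ⟨-, hΨu, hΨϖ⟩, hvS, hvsq, hvF⟩, hvD⟩, 𝔓, h𝔓, Φ, hΦ, hΦU⟩ :=
    absoluteGaloisGroup.exists_frobenius_mem_of_mem_nhds_one hUn h𝓛'
  simp only [Set.mem_setOf_eq] at hvD
  set p : ℕ := Ideal.absNorm v.asIdeal with hpdef
  have hp : p.Prime := hvD
  have hpv : (p : 𝓞 K) ∈ v.asIdeal := natCast_absNorm_mem_asIdeal v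
  have hpv2 : (p : 𝓞 K) ∉ v.asIdeal ^ 2 := hvsq hp
  have hvL : v ∉ L := fun h' => hvS (Finset.mem_union_left _ h')
  -- (7) principalisation `(c) 𝔭_v^{H₀} = (b)`, `π = b/c ≡ 1 mod^× 𝔪`
  obtain ⟨b, c, hb, hc, hccop, hbc, hideal⟩ :=
    hprin v.asIdeal v.ne_bot (isCoprime_prod_pow_of_not_mem L m' hvL)
  have hb' : (b : K) ≠ 0 := by exact_mod_cast hb
  have hc' : (c : K) ≠ 0 := by exact_mod_cast hc
  set π : Kˣ := Units.mk0 ((b : K) / c) (div_ne_zero hb' hc') with hπdef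
  have hπval : ∀ w : HeightOneSpectrum (𝓞 K),
      w.valuation K (π : K) = if w = v then WithZero.exp (-(H₀ : ℤ)) else 1 := fun w => by
    rw [hπdef, Units.val_mk0]
    exact valuation_div_eq_of_span_mul_pow_eq v hb hc hideal w
  have hπcong : ∀ w ∈ L, Valued.v (algebraMap K (w.adicCompletion K) (π : K) - 1) ≤
      WithZero.exp (-(m' : ℤ)) := by
    intro w hw
    rw [hπdef, Units.val_mk0]
    have hle : 𝔪 ≤ w.asIdeal ^ m' := prod_pow_le_pow L m' hw
    refine valued_div_sub_one_le w (hle hbc) (not_mem_of_isCoprime_span_of_le w hccop ?_)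
    exact hle.trans (Ideal.pow_le_self hm'0.ne')
  -- (8) Serre's identity at `π`: `(∏_{w ∈ L} Ψ⟨π⟩_w)^{N₁} · Ψ⟨π⟩_v^{N₁} = 1`
  have hπunitS : ∀ w ∈ S, (ℓ : 𝓞 K) ∉ w.asIdeal → w.valuation K (π : K) = 1 := by
    intro w hw _
    have hwv : w ≠ v := fun h' => hvS (h' ▸ hw)
    rw [hπval w, if_neg hwv]
  have hdisj : Disjoint S {v} := Finset.disjoint_singleton_right.mpr hvS
  have hπunit : ∀ w ∉ S ∪ {v}, w.valuation K (π : K) = 1 := by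
    intro w hw
    rw [hπval w, if_neg]
    exact fun h' => hw (Finset.mem_union_right _ (Finset.mem_singleton.mpr h'))
  have hE1 := hserre π hπunitS {v} hdisj hπunit
  rw [hSfilter, Finset.prod_singleton] at hE1
  -- `Ψ⟨π⟩_v = Ψ⟨ϖ₀⟩^{H₀}`
  set ϖ₀ : (v.adicCompletion K)ˣ := HeckeCharacter.uniformizer K v with hϖ₀
  have hϖ₀val : Valued.v (ϖ₀ : v.adicCompletion K) = WithZero.exp (-1 : ℤ) :=
    HeckeCharacter.valued_uniformizer v
  have hπv : Ψ (localUnits v (globalToLocalUnits v π)) = Ψ (localUnits v ϖ₀) ^ (H₀ : ℤ) := by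
    refine IdelicCharacter.map_localUnits_eq_zpow_of_valued Ψ hΨu hϖ₀val _ ?_
    rw [val_globalToLocalUnits, valued_algebraMap_adicCompletion, hπval v, if_pos rfl]
  rw [hπv] at hE1
  -- in `ℚ̄_ℓ`: `u₀ = Ψ⟨ϖ₀⟩`, `fL = ∏_{w∈L} Ψ⟨π⟩_w`
  set u₀ : PadicAlgCl ℓ := ((Ψ (localUnits v ϖ₀) : (PadicAlgCl ℓ)ˣ) : PadicAlgCl ℓ) with hu₀
  set fL : PadicAlgCl ℓ :=
    ∏ w ∈ L, ((Ψ (localUnits w (globalToLocalUnits w π)) : (PadicAlgCl ℓ)ˣ) : PadicAlgCl ℓ) with hfL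
  have hu₀0 : u₀ ≠ 0 := Units.ne_zero _
  have hfL0 : fL ≠ 0 := Finset.prod_ne_zero_iff.mpr fun _ _ => Units.ne_zero _
  have hE1' : fL ^ N₁ * (u₀ ^ (H₀ : ℤ)) ^ N₁ = 1 := by
    have := congrArg (fun z : (PadicAlgCl ℓ)ˣ => (z : PadicAlgCl ℓ)) hE1
    simpa only [Units.val_mul, Units.val_pow_eq_pow_val, Units.coe_prod, Units.val_zpow_eq_zpow_val,
      Units.val_one] using this
  have hE2 : fL ^ N = ∏ τ : K →+* PadicAlgCl ℓ, τ (π : K) ^ (-(n τ)) := hLA' π hπcong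
  -- hence `u₀ ^ B = ∏_τ τ(π)^{n_τ N₁}`
  have hkey : u₀ ^ B = ∏ τ : K →+* PadicAlgCl ℓ, τ (π : K) ^ (n τ * N₁) := by
    -- `u₀^{H₀ N₁} = fL^{-N₁}`
    have h1 : u₀ ^ (H₀ * N₁) = (fL ^ N₁)⁻¹ := by
      have h2 := eq_inv_of_mul_eq_one_right hE1'
      rwa [zpow_natCast, ← pow_mul] at h2
    calc u₀ ^ B = (u₀ ^ (H₀ * N₁)) ^ N := by rw [hBdef, pow_mul]
      _ = ((fL ^ N) ^ N₁)⁻¹ := by rw [h1, inv_pow, ← pow_mul, ← pow_mul, mul_comm]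
      _ = (∏ τ : K →+* PadicAlgCl ℓ, τ (π : K) ^ (-(n τ))) ^ (-(N₁ : ℤ)) := by
            rw [hE2, zpow_neg, zpow_natCast]
      _ = ∏ τ : K →+* PadicAlgCl ℓ, τ (π : K) ^ (n τ * N₁) := by
            rw [← Finset.prod_zpow]
            refine Finset.prod_congr rfl fun τ _ => ?_
            rw [← zpow_mul, neg_mul_neg]
  -- (9) `x Φ = u₀`
  have hxΦ : x Φ = u₀ :=
    (FramedGaloisRep.hasFrobCharpolyAt_iff_of_rank_one ψ v u₀).mp (hΨϖ ϖ₀ hϖ₀val) 𝔓 h𝔓 Φ hΦ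
  -- (10) gcd descent: `x Φ ∈ F`
  set b₀ : F := ∏ τ : K →+* PadicAlgCl ℓ, (τF τ (π : K)) ^ (n τ * N₁) with hb₀
  have hb₀val : iF b₀ = ∏ τ : K →+* PadicAlgCl ℓ, τ (π : K) ^ (n τ * N₁) := by
    rw [hb₀, map_prod]
    refine Finset.prod_congr rfl fun τ _ => ?_
    rw [map_zpow₀, hiF, hτF_val]
  have hxb : x Φ ^ B = iF b₀ := by rw [hxΦ, hkey, hb₀val]
  have hρv : ρ.HasFrobCharpolyAt v ((P.map eF).map iF) := by
    rw [Polynomial.map_map, heF_comp]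
    exact hP
  have hY : ∀ ζ : PadicAlgCl ℓ, ζ ^ B = 1 → ((P.map eF).map iF).IsRoot (ζ * x Φ) → ζ = 1 := by
    intro ζ hζ hroot
    by_contra hne
    have h2 := Set.mem_iInter₂.mp hΦU ζ ⟨hζ, hne⟩
    simp only [Set.mem_setOf_eq] at h2
    apply h2
    rw [hρv 𝔓 h𝔓 Φ hΦ]
    exact hroot
  obtain ⟨y, hy⟩ := WeaklyDivides.apply_mem_range_of_pow_eq iF h hρv h𝔓 hΦ hB.ne' hxb hY
  -- `y^B = b₀` in `F`, `y ≠ 0`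
  have hyB : y ^ B = b₀ := hiFinj (by rw [map_pow, hy, hxb])
  have hy0 : y ≠ 0 := by
    rintro rfl
    rw [map_zero] at hy
    exact hu₀0 (hxΦ ▸ hy.symm)
  -- (11) a place `w` of `F` over `v` along `τ₀`, and the valuations of the `τ(π)`
  obtain ⟨w, hw⟩ := exists_comap_eq_of_ringHom (τF τ₀) v
  have hpw : (p : 𝓞 F) ∈ w.asIdeal := by
    have h1 : RingOfIntegers.mapRingHom (τF τ₀) (p : 𝓞 K) ∈ w.asIdeal := by
      rw [← Ideal.mem_comap, hw]
      exact hpv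
    rwa [map_natCast] at h1
  have hwunder : w.under (𝓞 ℚ) = v.under (𝓞 ℚ) := by
    refine Rat.eq_of_natCast_prime_mem hp ?_ ?_
    · change algebraMap (𝓞 ℚ) (𝓞 F) (p : 𝓞 ℚ) ∈ w.asIdeal
      rwa [map_natCast]
    · change algebraMap (𝓞 ℚ) (𝓞 K) (p : 𝓞 ℚ) ∈ v.asIdeal
      rwa [map_natCast]
  have hpw2 : (p : 𝓞 F) ∉ w.asIdeal ^ 2 :=
    natCast_not_mem_sq_of_isUnramifiedIn w hp hpw (hwunder ▸ hvF)
  have hwp : w.valuation F (p : F) = WithZero.exp (-(1 : ℤ)) := by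
    rw [show (p : F) = algebraMap (𝓞 F) F (p : 𝓞 F) by simp, valuation_of_algebraMap]
    exact intValuation_natCast_eq_exp_neg_one w hpw hpw2
  have hvp : v.valuation K (p : K) = WithZero.exp (-(1 : ℤ)) := by
    rw [show (p : K) = algebraMap (𝓞 K) K (p : 𝓞 K) by simp, valuation_of_algebraMap]
    exact intValuation_natCast_eq_exp_neg_one v hpv hpv2
  -- valuations along each `τ`
  have hval : ∀ τ : K →+* PadicAlgCl ℓ, w.valuation F (τF τ (π : K)) =
      if τ = τ₀ then WithZero.exp (-(H₀ : ℤ)) else 1 := by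
    intro τ
    obtain ⟨𝔮, eτ, heτ, h𝔮, hvalτ⟩ := exists_valuation_comp_eq_pow (τF τ) w
    by_cases h𝔮v : 𝔮 = v
    · -- then `τ` carries `𝔭_v` into `w`, as does `τ₀`: rigidity
      have hτ : ∀ a ∈ v.asIdeal, RingOfIntegers.mapRingHom (τF τ) a ∈ w.asIdeal := by
        intro a ha
        rw [← Ideal.mem_comap, ← h𝔮, h𝔮v]
        exact ha
      have hτ₀ : ∀ a ∈ v.asIdeal, RingOfIntegers.mapRingHom (τF τ₀) a ∈ w.asIdeal := by
        intro a ha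
        rw [← Ideal.mem_comap, hw]
        exact ha
      have heq : τF τ = τF τ₀ :=
        NumberField.ringHom_eq_of_map_mem v hp rfl hpv2 w.isPrime.ne_top (τF τ) (τF τ₀) hτ hτ₀
      have hττ₀ : τ = τ₀ := hτFinj τ τ₀ heq
      subst hττ₀
      -- `e_τ = 1` from the valuation of `p`
      have he1 : eτ = 1 := by
        have h1 := hvalτ (p : K)
        rw [map_natCast, hwp, h𝔮v, hvp] at h1
        exact (eq_one_of_exp_neg_one_pow_eq h1.symm)
      rw [if_pos rfl, hvalτ, h𝔮v, hπval v, if_pos rfl, he1, pow_one]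
    · have hne : τ ≠ τ₀ := by
        rintro rfl
        apply h𝔮v
        exact HeightOneSpectrum.ext (h𝔮.trans hw)
      rw [if_neg hne, hvalτ, hπval 𝔮, if_neg h𝔮v, one_pow]
  -- (12) take `|·|_w` of `y^B = b₀`
  have hvaly : w.valuation F y ≠ 0 := (Valuation.ne_zero_iff _).mpr hy0
  have hyval : (w.valuation F y) ^ B = (WithZero.exp (-(H₀ : ℤ))) ^ (n τ₀ * N₁) := by
    have h1 := congrArg (w.valuation F) hyB
    rw [map_pow, hb₀, map_prod] at h1
    rw [h1, Finset.prod_eq_single τ₀]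
    · rw [map_zpow₀, hval τ₀, if_pos rfl]
    · intro τ _ hτ
      rw [map_zpow₀, hval τ, if_neg hτ, one_zpow]
    · intro hτ₀
      exact absurd (Finset.mem_univ τ₀) hτ₀
  -- write `|y|_w = exp t` and compare exponents
  set t : ℤ := WithZero.log (w.valuation F y) with ht
  have hyt : w.valuation F y = WithZero.exp t := (WithZero.exp_log hvaly).symm
  rw [hyt, ← zpow_natCast, ← WithZero.exp_zsmul, ← WithZero.exp_zsmul, WithZero.exp_inj] at hyval
  simp only [smul_eq_mul] at hyval
  -- `hyval : B * t = (n τ₀ * N₁) * (-H₀)`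
  have hH : ((H₀ : ℤ) * N₁) ≠ 0 := by exact_mod_cast (Nat.mul_pos hH₀ hN₁).ne'
  refine ⟨-t, ?_⟩
  have e1 : ((B : ℕ) : ℤ) = (H₀ : ℤ) * N₁ * N := by rw [hBdef]; push_cast; ring
  rw [e1] at hyval
  have h2 : (H₀ : ℤ) * N₁ * (N * (-t)) = (H₀ : ℤ) * N₁ * n τ₀ := by linear_combination (-1 : ℤ) * hyval
  exact (mul_left_cancel₀ hH h2).symm

/-! ### Part B: `ℓ`-adic smallness of `τ(k) - 1` and exact local algebraicity -/

omit [NumberField K] [Fact ℓ.Prime] in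
/-- An integer prime to `ℓ` lies in no prime above `ℓ`. [folklore] -/
theorem natCast_not_mem_of_not_dvd {v : HeightOneSpectrum (𝓞 K)} {q : ℕ} (hq : ℓ.Prime)
    (hv : (ℓ : 𝓞 K) ∈ v.asIdeal) (hqℓ : ¬ ℓ ∣ q) : (q : 𝓞 K) ∉ v.asIdeal := by
  intro hqv
  have hcop : Nat.Coprime ℓ q := (Nat.Prime.coprime_iff_not_dvd hq).mpr hqℓ
  obtain ⟨a, b, hab⟩ := Nat.isCoprime_iff_coprime.mpr hcop
  have h1 : (1 : 𝓞 K) ∈ v.asIdeal := by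
    have : ((a * ℓ + b * q : ℤ) : 𝓞 K) = 1 := by rw [hab]; push_cast; ring
    rw [← this]
    push_cast
    exact v.asIdeal.add_mem (v.asIdeal.mul_mem_left _ hv) (v.asIdeal.mul_mem_left _ hqv)
  exact v.isPrime.ne_top ((Ideal.eq_top_iff_one _).mpr h1)

/-- **`ℓ`-integral elements have `ℓ`-adically bounded embeddings**: if `z ∈ K` satisfies
`|z|_v ≤ 1` at every place `v ∣ ℓ`, then `‖τ(z)‖ ≤ 1` for every embedding `τ : K → ℚ̄_ℓ`.  (With
`t = N((d)) = d d̃ ∈ ℕ` for a denominator `d` of `z` and `t = ℓ^r t'`, `ℓ ∤ t'`, the element `t' z`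
is integral at EVERY place, hence an algebraic integer, and `‖t'‖_ℓ = 1`.) [folklore] -/
theorem norm_embedding_le_one_of_valuation_le_one {z : K}
    (hz : ∀ v : HeightOneSpectrum (𝓞 K), (ℓ : 𝓞 K) ∈ v.asIdeal → v.valuation K z ≤ 1)
    (τ : K →+* PadicAlgCl ℓ) : ‖τ z‖ ≤ 1 := by
  classical
  have hℓ : ℓ.Prime := Fact.out
  -- a denominator `d` and `t = N((d)) = d d̃`
  obtain ⟨a, d, hd, hadz⟩ := IsFractionRing.div_surjective (A := 𝓞 K) z
  have hd' : (d : K) ≠ 0 := by exact_mod_cast nonZeroDivisors.ne_zero hd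
  have hdz : (d : K) * z = a := by rw [← hadz]; field_simp
  set t : ℕ := Ideal.absNorm (Ideal.span {(d : 𝓞 K)}) with htdef
  have htmem : (t : 𝓞 K) ∈ Ideal.span {(d : 𝓞 K)} := Ideal.absNorm_mem _
  obtain ⟨dt, hdt⟩ := Ideal.mem_span_singleton'.mp htmem
  have ht0 : t ≠ 0 := by
    rw [htdef, Ne, Ideal.absNorm_eq_zero_iff, Ideal.span_singleton_eq_bot]
    exact nonZeroDivisors.ne_zero hd
  obtain ⟨r, t', ht', htt'⟩ := Nat.exists_eq_pow_mul_and_not_dvd ht0 ℓ hℓ.ne_one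
  -- `t' z` is integral everywhere
  have hint : ∀ v : HeightOneSpectrum (𝓞 K), v.valuation K ((t' : K) * z) ≤ 1 := by
    intro v
    by_cases hv : (ℓ : 𝓞 K) ∈ v.asIdeal
    · have ht'v : v.valuation K (t' : K) = 1 := by
        rw [show (t' : K) = algebraMap (𝓞 K) K (t' : 𝓞 K) by simp, valuation_eq_one_iff_notMem]
        exact natCast_not_mem_of_not_dvd hℓ hv ht'
      rw [map_mul, ht'v, one_mul]
      exact hz v hv
    · -- `t z = d̃ (d z) = d̃ a` is integral and `|ℓ^r|_v = 1`
      have hℓv : v.valuation K (ℓ : K) = 1 := by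
        rw [show (ℓ : K) = algebraMap (𝓞 K) K (ℓ : 𝓞 K) by simp, valuation_eq_one_iff_notMem]
        exact hv
      have htz : v.valuation K ((t : K) * z) ≤ 1 := by
        have e1 : (t : K) * z = ((dt * a : 𝓞 K) : K) := by
          have : (t : K) = ((dt * d : 𝓞 K) : K) := by
            rw [hdt]; simp
          rw [this]
          push_cast
          rw [mul_assoc, hdz]
        rw [e1, show ((dt * a : 𝓞 K) : K) = algebraMap (𝓞 K) K (dt * a) from rfl]
        exact valuation_le_one v _
      have e2 : (t' : K) * z = (t : K) * z * ((ℓ : K) ^ r)⁻¹ := by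
        have hℓ0 : (ℓ : K) ≠ 0 := by exact_mod_cast hℓ.ne_zero
        rw [htt']
        push_cast
        field_simp
      rw [e2, map_mul, map_inv₀, map_pow, hℓv, one_pow, inv_one, mul_one]
      exact htz
  obtain ⟨y, hy⟩ := mem_integers_of_valuation_le_one K ((t' : K) * z) hint
  -- `‖τ(t' z)‖ ≤ 1` and `‖t'‖ = 1`
  have h1 : ‖τ ((t' : K) * z)‖ ≤ 1 := by
    rw [← hy]
    exact norm_embedding_coe_le_one τ y
  have h2 : ‖τ (t' : K)‖ = 1 := by
    rw [map_natCast]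
    exact PadicAlgCl.norm_natCast_eq_one_of_not_dvd ht'
  rw [map_mul, norm_mul, h2, one_mul] at h1
  exact h1

/-- **Congruences at the places above `ℓ` control `‖τ(k) - 1‖`**: if `|k - 1|_v ≤ |ℓ|_v^j` at
every `v ∣ ℓ` then `‖τ(k) - 1‖ ≤ ‖ℓ‖^j` under every embedding `τ : K → ℚ̄_ℓ`. [folklore] -/
theorem norm_embedding_sub_one_le {k : K} {j : ℕ}
    (hk : ∀ v : HeightOneSpectrum (𝓞 K), (ℓ : 𝓞 K) ∈ v.asIdeal →
      v.valuation K (k - 1) ≤ v.valuation K ((ℓ : K) ^ j))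
    (τ : K →+* PadicAlgCl ℓ) : ‖τ k - 1‖ ≤ ‖(ℓ : PadicAlgCl ℓ)‖ ^ j := by
  have hℓ : ℓ.Prime := Fact.out
  have hℓ0 : (ℓ : K) ≠ 0 := by exact_mod_cast hℓ.ne_zero
  set z : K := (k - 1) / (ℓ : K) ^ j with hzdef
  have hkz : k - 1 = (ℓ : K) ^ j * z := by rw [hzdef]; field_simp
  have hz : ∀ v : HeightOneSpectrum (𝓞 K), (ℓ : 𝓞 K) ∈ v.asIdeal → v.valuation K z ≤ 1 := by
    intro v hv
    have hpow0 : v.valuation K ((ℓ : K) ^ j) ≠ 0 := (Valuation.ne_zero_iff _).mpr (pow_ne_zero _ hℓ0)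
    rw [hzdef, map_div₀, div_le_one₀ (zero_lt_iff.mpr hpow0)]
    exact hk v hv
  have h1 := norm_embedding_le_one_of_valuation_le_one hz τ
  rw [← map_one τ, ← map_sub, hkz, map_mul, map_pow, map_natCast, norm_mul, norm_pow]
  calc ‖(ℓ : PadicAlgCl ℓ)‖ ^ j * ‖τ z‖ ≤ ‖(ℓ : PadicAlgCl ℓ)‖ ^ j * 1 :=
        mul_le_mul_of_nonneg_left h1 (pow_nonneg (norm_nonneg _) _)
    _ = ‖(ℓ : PadicAlgCl ℓ)‖ ^ j := mul_one _

/-- **Part B: exact local algebraicity with exponents `n/N`.**  If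
`(∏_{v∈L} Ψ(⟨k⟩_v))^N = ∏_τ τ(k)^{-n_τ}` for `k ≡ 1 mod 𝔭_v^m` on `L = S_ℓ` and `N ∣ n_τ` for all
`τ`, then for some `m₁`, `∏_{v∈L} Ψ(⟨k⟩_v) = ∏_τ τ(k)^{-n_τ/N}` for `k ≡ 1 mod 𝔭_v^{m₁}` on `L`: the
quotient of the two sides is an `N`-th root of unity within `‖ℓ‖` of `1` (continuity of `Ψ` on the
local units, `IdelicCharacter.exists_forall_valued_le_norm_sub_one_lt`; `norm_embedding_sub_one_le`),
hence `1` (`PadicAlgCl.eq_one_of_pow_eq_one_of_norm_sub_one_lt`). [cite: BockleHui2025, Proposition 2.12] -/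
theorem locAlg_of_pow_of_dvd (Ψ : ideleGroup K →ₜ* (PadicAlgCl ℓ)ˣ)
    (L : Finset (HeightOneSpectrum (𝓞 K))) (hL : ∀ v, v ∈ L ↔ (ℓ : 𝓞 K) ∈ v.asIdeal)
    {N : ℕ} (hN : 0 < N) (n : (K →+* PadicAlgCl ℓ) → ℤ) (m : ℕ)
    (hLA : ∀ k : Kˣ, (∀ v ∈ L, Valued.v (algebraMap K (v.adicCompletion K) (k : K) - 1) ≤
        WithZero.exp (-(m : ℤ))) →
      (∏ v ∈ L, ((Ψ (localUnits v (globalToLocalUnits v k)) : (PadicAlgCl ℓ)ˣ) : PadicAlgCl ℓ)) ^ N =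
        ∏ τ : K →+* PadicAlgCl ℓ, τ (k : K) ^ (-(n τ)))
    (hdvd : ∀ τ : K →+* PadicAlgCl ℓ, (N : ℤ) ∣ n τ) :
    ∃ m₁ : ℕ, ∀ k : Kˣ, (∀ v ∈ L, Valued.v (algebraMap K (v.adicCompletion K) (k : K) - 1) ≤
        WithZero.exp (-(m₁ : ℤ))) →
      (∏ v ∈ L, ((Ψ (localUnits v (globalToLocalUnits v k)) : (PadicAlgCl ℓ)ˣ) : PadicAlgCl ℓ)) =
        ∏ τ : K →+* PadicAlgCl ℓ, τ (k : K) ^ (-(n τ / N)) := by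
  classical
  have hℓp : ℓ.Prime := Fact.out
  -- the thresholds: continuity of `Ψ` at each `v`, and `|ℓ|_v = exp(-M_v)`
  have hℓnorm0 : 0 < ‖(ℓ : PadicAlgCl ℓ)‖ := by
    rw [PadicAlgCl.norm_natCast_self]
    exact inv_pos.mpr (by exact_mod_cast hℓp.pos)
  have hℓnorm1 : ‖(ℓ : PadicAlgCl ℓ)‖ < 1 := PadicAlgCl.norm_natCast_self_lt_one
  choose ev hev using fun v : HeightOneSpectrum (𝓞 K) =>
    IdelicCharacter.exists_forall_valued_le_norm_sub_one_lt Ψ v hℓnorm0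
  have hM : ∀ v : HeightOneSpectrum (𝓞 K), ∃ M : ℕ,
      Valued.v ((ℓ : 𝓞 K) : v.adicCompletion K) = WithZero.exp (-(M : ℤ)) := by
    intro v
    have hne : (ℓ : 𝓞 K) ≠ 0 := by exact_mod_cast hℓp.ne_zero
    refine ⟨(Associates.mk v.asIdeal).count (Associates.mk (Ideal.span {(ℓ : 𝓞 K)})).factors, ?_⟩
    rw [show ((ℓ : 𝓞 K) : v.adicCompletion K) = algebraMap K (v.adicCompletion K) ((ℓ : 𝓞 K) : K)
      from rfl, valued_algebraMap_adicCompletion,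
      show ((ℓ : 𝓞 K) : K) = algebraMap (𝓞 K) K (ℓ : 𝓞 K) from rfl, valuation_of_algebraMap,
      v.intValuation_if_neg hne]
  choose Mv hMv using hM
  set m₁ : ℕ := m + 1 + L.sup ev + 2 * L.sup Mv with hm₁
  have hγ1 : WithZero.exp (-(m₁ : ℤ)) < 1 := by
    rw [← WithZero.exp_zero, WithZero.exp_lt_exp]; omega
  -- the one-units subgroup of radius `‖ℓ‖`
  obtain ⟨U, hU, -⟩ := exists_subgroup_units_norm_sub_one_lt (L := PadicAlgCl ℓ) hℓnorm0 hℓnorm1.le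
  refine ⟨m₁, fun k hk => ?_⟩
  -- (i) `∏_{v∈L} Ψ⟨k⟩_v ∈ U`
  have hkunit : ∀ v ∈ L, ∃ u : (v.adicCompletionIntegers K)ˣ,
      Units.map ((v.adicCompletionIntegers K).subtype : _ →* _) u = globalToLocalUnits v k ∧
      Valued.v (((u : v.adicCompletionIntegers K) : v.adicCompletion K) - 1) ≤
        WithZero.exp (-(ev v : ℤ)) := by
    intro v hv
    have h1 : Valued.v ((globalToLocalUnits v k : (v.adicCompletion K)ˣ) : v.adicCompletion K) = 1 := by
      rw [val_globalToLocalUnits]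
      exact valued_eq_one_of_valued_sub_one_lt_one ((hk v hv).trans_lt hγ1)
    obtain ⟨u, hu⟩ := IdelicCharacter.exists_unitsMap_eq_of_valued_eq_one _ h1
    refine ⟨u, hu, ?_⟩
    have hcoe : ((u : v.adicCompletionIntegers K) : v.adicCompletion K) =
        algebraMap K (v.adicCompletion K) (k : K) := by
      have := congrArg (fun w : (v.adicCompletion K)ˣ => (w : v.adicCompletion K)) hu
      simpa using this
    rw [hcoe]
    refine (hk v hv).trans (WithZero.exp_le_exp.mpr ?_)
    have := Finset.le_sup (f := ev) hv
    omega
  have hΨU : ∀ v ∈ L, Ψ (localUnits v (globalToLocalUnits v k)) ∈ U := by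
    intro v hv
    obtain ⟨u, hu, hcong⟩ := hkunit v hv
    rw [hU, ← hu]
    exact hev v u hcong
  have hprodU : (∏ v ∈ L, Ψ (localUnits v (globalToLocalUnits v k))) ∈ U :=
    Subgroup.prod_mem U fun v hv => hΨU v hv
  -- (ii) `τ(k) ∈ U`
  have hkcong : ∀ v : HeightOneSpectrum (𝓞 K), (ℓ : 𝓞 K) ∈ v.asIdeal →
      v.valuation K ((k : K) - 1) ≤ v.valuation K ((ℓ : K) ^ 2) := by
    intro v hvℓ
    have hv : v ∈ L := (hL v).mpr hvℓ
    have h1 := hk v hv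
    rw [← map_one (algebraMap K (v.adicCompletion K)), ← map_sub, valued_algebraMap_adicCompletion]
      at h1
    refine h1.trans ?_
    rw [map_pow, show (ℓ : K) = algebraMap (𝓞 K) K (ℓ : 𝓞 K) by simp,
      ← valued_algebraMap_adicCompletion, show algebraMap K (v.adicCompletion K)
        (algebraMap (𝓞 K) K (ℓ : 𝓞 K)) = ((ℓ : 𝓞 K) : v.adicCompletion K) from rfl, hMv v,
      ← WithZero.exp_nsmul, WithZero.exp_le_exp]
    have := Finset.le_sup (f := Mv) hv
    rw [two_nsmul]
    omega
  have hτU : ∀ τ : K →+* PadicAlgCl ℓ, Units.mk0 (τ (k : K)) ((map_ne_zero τ).mpr k.ne_zero) ∈ U := by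
    intro τ
    rw [hU, Units.val_mk0]
    refine (norm_embedding_sub_one_le hkcong τ).trans_lt ?_
    calc ‖(ℓ : PadicAlgCl ℓ)‖ ^ 2 < ‖(ℓ : PadicAlgCl ℓ)‖ ^ 1 :=
          pow_lt_pow_right_of_lt_one₀ hℓnorm0 hℓnorm1 (by norm_num)
      _ = ‖(ℓ : PadicAlgCl ℓ)‖ := pow_one _
  have halgU : (∏ τ : K →+* PadicAlgCl ℓ,
      (Units.mk0 (τ (k : K)) ((map_ne_zero τ).mpr k.ne_zero)) ^ (n τ / N)) ∈ U :=
    Subgroup.prod_mem U fun τ _ => Subgroup.zpow_mem U (hτU τ) _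
  -- (iii) the quotient `g` is `N`-torsion in `U`, hence `1`
  set gΨ : (PadicAlgCl ℓ)ˣ := ∏ v ∈ L, Ψ (localUnits v (globalToLocalUnits v k)) with hgΨ
  set galg : (PadicAlgCl ℓ)ˣ := ∏ τ : K →+* PadicAlgCl ℓ,
      (Units.mk0 (τ (k : K)) ((map_ne_zero τ).mpr k.ne_zero)) ^ (n τ / N) with hgalg
  have hgΨval : (gΨ : PadicAlgCl ℓ) =
      ∏ v ∈ L, ((Ψ (localUnits v (globalToLocalUnits v k)) : (PadicAlgCl ℓ)ˣ) : PadicAlgCl ℓ) := by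
    rw [hgΨ, Units.coe_prod]
  have hgalgval : (galg : PadicAlgCl ℓ) = ∏ τ : K →+* PadicAlgCl ℓ, τ (k : K) ^ (n τ / N) := by
    rw [hgalg, Units.coe_prod]
    refine Finset.prod_congr rfl fun τ _ => ?_
    rw [Units.val_zpow_eq_zpow_val, Units.val_mk0]
  have hm_le : ∀ v ∈ L, Valued.v (algebraMap K (v.adicCompletion K) (k : K) - 1) ≤
      WithZero.exp (-(m : ℤ)) := fun v hv =>
    (hk v hv).trans (WithZero.exp_le_exp.mpr (by omega))
  have hpowN : ((gΨ * galg : (PadicAlgCl ℓ)ˣ) : PadicAlgCl ℓ) ^ N = 1 := by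
    rw [Units.val_mul, mul_pow, hgΨval, hLA k hm_le, hgalgval, ← Finset.prod_pow,
      ← Finset.prod_mul_distrib]
    refine Finset.prod_eq_one fun τ _ => ?_
    obtain ⟨q, hq⟩ := hdvd τ
    have hq' : n τ / N = q := by
      rw [hq, Int.mul_ediv_cancel_left _ (by exact_mod_cast hN.ne')]
    rw [hq', hq, ← zpow_natCast (τ (k : K) ^ q), ← zpow_mul,
      ← zpow_add₀ ((map_ne_zero τ).mpr k.ne_zero), show -((N : ℤ) * q) + q * N = 0 by ring, zpow_zero]
  have hmem : gΨ * galg ∈ U := U.mul_mem hprodU halgU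
  have hclose : ‖((gΨ * galg : (PadicAlgCl ℓ)ˣ) : PadicAlgCl ℓ) - 1‖ < ‖(ℓ : PadicAlgCl ℓ)‖ :=
    (hU _).mp hmem
  have hone : ((gΨ * galg : (PadicAlgCl ℓ)ˣ) : PadicAlgCl ℓ) = 1 :=
    PadicAlgCl.eq_one_of_pow_eq_one_of_norm_sub_one_lt hclose hN hpowN
  -- conclude
  rw [Units.val_mul, hgΨval, hgalgval] at hone
  rw [eq_inv_of_mul_eq_one_left hone, ← Finset.prod_inv_distrib]
  refine Finset.prod_congr rfl fun τ _ => ?_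
  rw [zpow_neg]

/-! ### Assembly -/

/-- **Böckle–Hui Thm. 1.1 for characters, Hecke form, general `K`, from almost local
algebraicity.**  Let `ρ : Γ_K → GL_d(ℚ̄_ℓ)` be `E`-rational, `ψ : Γ_K → GL_1(ℚ̄_ℓ)` a character
weakly dividing `ρ`, `Ψ = ψ ∘ Art_K` an idelic avatar of `ψ` (trivial on `Kˣ`; at almost all `v`:
`ψ` unramified, `Ψ(⟨𝒪_vˣ⟩) = 1`, `ψ(Frob_v) = Ψ(⟨ϖ⟩_v)`), `L = S_ℓ`, and suppose `Ψ` ALMOST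
locally algebraic at `L`: `(∏_{v∈L} Ψ(⟨k⟩_v))^N = ∏_τ τ(k)^{-n_τ}` for `k ≡ 1 mod 𝔭_v^m` on `L`
(the conclusion of BH Thm. 2.2 for `ψ`).  Then for every `ι : ℚ̄_ℓ ≃+* ℂ` there is an algebraic
Hecke character `χ` with `χ`, `ψ` unramified and `ψ.HasFrobCharpolyAt v (X - C (ι⁻¹(χ(ϖ_v))⁻¹))` at
all but finitely many `v` — the conclusion of `exists_heckeCharacter_of_weaklyDivides`
(`natCast_dvd_exponent_of_weaklyDivides` + `locAlg_of_pow_of_dvd` +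
`exists_heckeCharacter_of_isLocAlgAt`).
[cite: BockleHui2025, Theorem 1.1, §2.7 (proof), Propositions 2.11–2.12, §3.2.1] -/
theorem WeaklyDivides.exists_heckeCharacter_of_almostLocAlg
    {E : Type} [Field E] [NumberField E] (e : E →+* PadicAlgCl ℓ) {d : ℕ}
    {ρ : FramedGaloisRep K (PadicAlgCl ℓ) d} (hρ : ρ.IsRationalOver e)
    {ψ : FramedGaloisRep K (PadicAlgCl ℓ) 1} (h : ψ.WeaklyDivides ρ)
    (Ψ : ideleGroup K →ₜ* (PadicAlgCl ℓ)ˣ) (hK : ∀ x ∈ principalIdeles K, Ψ x = 1)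
    (hΨ : ∀ᶠ v : HeightOneSpectrum (𝓞 K) in cofinite, ψ.IsUnramifiedAt v ∧
      (∀ u : (v.adicCompletionIntegers K)ˣ,
          Ψ (localUnits v (Units.map ((v.adicCompletionIntegers K).subtype : _ →* _) u)) = 1) ∧
      ∀ ϖ : (v.adicCompletion K)ˣ, Valued.v (ϖ : v.adicCompletion K) = WithZero.exp (-1 : ℤ) →
        ψ.HasFrobCharpolyAt v
          (Polynomial.X - Polynomial.C ((Ψ (localUnits v ϖ) : (PadicAlgCl ℓ)ˣ) : PadicAlgCl ℓ)))
    (L : Finset (HeightOneSpectrum (𝓞 K))) (hL : ∀ v, v ∈ L ↔ (ℓ : 𝓞 K) ∈ v.asIdeal)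
    {N : ℕ} (hN : 0 < N) (n : (K →+* PadicAlgCl ℓ) → ℤ) (m : ℕ)
    (hLA : ∀ k : Kˣ, (∀ v ∈ L, Valued.v (algebraMap K (v.adicCompletion K) (k : K) - 1) ≤
        WithZero.exp (-(m : ℤ))) →
      (∏ v ∈ L, ((Ψ (localUnits v (globalToLocalUnits v k)) : (PadicAlgCl ℓ)ˣ) : PadicAlgCl ℓ)) ^ N =
        ∏ τ : K →+* PadicAlgCl ℓ, τ (k : K) ^ (-(n τ)))
    (ι : PadicAlgCl ℓ ≃+* ℂ) :
    ∃ χ : HeckeCharacter K, χ.IsAlgebraic ∧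
      ∀ᶠ v : HeightOneSpectrum (𝓞 K) in cofinite, χ.IsUnramifiedAt v ∧ ψ.IsUnramifiedAt v ∧
        ψ.HasFrobCharpolyAt v (Polynomial.X - Polynomial.C (ι.symm (χ.valueAtUniformizer v)⁻¹)) := by
  have hdvd : ∀ τ : K →+* PadicAlgCl ℓ, (N : ℤ) ∣ n τ := fun τ =>
    natCast_dvd_exponent_of_weaklyDivides e hρ h Ψ hK hΨ L hL hN n m hLA τ
  obtain ⟨m₁, hLA₁⟩ := locAlg_of_pow_of_dvd Ψ L hL hN n m hLA hdvd
  exact exists_heckeCharacter_of_isLocAlgAt ψ Ψ hK hΨ L (fun v hv => (hL v).mpr hv)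
    (fun τ => n τ / N) m₁ hLA₁ ι

end FramedGaloisRep

end Literature.NumberTheory.GaloisRepresentations
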